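import Summits.ResolutionOfSingularities.ResolutionOfSingularities.Theorems.HilbertSamuelEliminationSigmaMaxModificationsCorridor3SigmaPersistentContactCover
import Literature.AlgebraicGeometry.Resolution.MonomialPart
import HarnessLib

/-!
# [OURS · L1 W4.2] σ-LAYER — `Corridor3SigmaTameValueIntrinsic`: (G2a) «THE TAME VALUE `S` IS INTRINSIC», STATEMENT-FIRST — the chart-level residual
# `N_H = (C_H : M(C_H))` of the Diff-coefficient ideal on a maximal-contact chart, its order `S_H`, the LAW `TameValueIntrinsic` («two charts read the same
# `S` at every common point of `Sing_m`»), and — PROVED from the law — the GLUED value of a contact cover with the dictionary (B1)(i) «`S ≥ S₀` ⟺ `ord N ≥ S₀`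
# on ANY chart through the point»
# (res-L1-w42-plan-1 RULING v3.14-51a (51a-E) «THEN (G2a) `TameValueIntrinsic` STATEMENT-ONLY (un-parked: (B1)(i) reads «ord N ≥ S₀» as «S ≥ S₀» through it)»;
# TAME-FORK.md ADDENDUM B, B1 «S = order of the GLOBAL residual N of the coefficient ideal on a maximal-contact hypersurface H — N := I·∏_D I(D)^{−a_D}, a_D =
# generic order of I along the member D … RESIDUE = (G2a): S must be INTRINSIC (independent of the choice of H and of the frame, at closed and non-closed
# points)», B6; RULING v3.14-45 (G2a); seat res-L1-type-o2 g9 = «res-type-067/068 SUCCESSOR»; `--supports stmt-ResolutionOfSingularities-19249 --as helper`,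
# counted 0)

HONEST FRAMING. OURS bookkeeping + ONE OPEN CLAIM STATED, NOT PROVED: `TameValueIntrinsic φ J m E` (§2) is a `Prop` the consumers take as a HYPOTHESIS
(`hG2a`) until it is proved or refuted (expected route: a Cossart–Piltant 2019 Prop. 2.3/2.4-type / CJS LNM 2270 Ch. 8-type invariance of the residual
order read on different maximal-contact hypersurfaces in the TAME regime `p ∤ m`; NOT claimed here, NOT a named fact, NO source asserts it in this form).
Everything else is a definition over the tree's vocabulary (`diffIdealSheaf` = Grothendieck `Diff^{≤ i}`, `nonmonomialPart` = Kollár's `(I : M(I))`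
3.110, `idealOrder`, this seat's `ContactChart`/`ContactCover` p568042) or a theorem PROVED from the law. The coefficient ideal used is the `Diff^{≤ i}`
TWIN of BGMW's `MarkedIdeal.coeff` (Def. 3.9.2, iterated first-order derivations): same exponents `∏_{j ≠ i} (m − j)`, with `Diff^{≤ i}` in place of `𝒟ⁱ`
because the tame hypothesis is `p ∤ m`, not `p > m` (the two agree when `(m−1)!` is invertible). NOTHING here is a statement of H. Hironaka's manuscript
[Hironaka2017] nor of Cutkosky 2009 / Cossart–Jannsen–Saito / Cossart–Piltant. No `instance`, no axiom, no `sorry`. AI-typed; AI review weaker than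
expert review.

## Contents (namespace `…Theorems.SigmaMaxModificationsCorridor3.Sigma`)

* §1 ON ONE CHART `ch : ContactChart φ J m` (open `U`, contact ideal sheaf `H` on `U`): `ContactChart.pt` (the point of `W` under a point of `V(H)`),
  `ContactChart.coeffIdeal` (`C := Σ_{i<m} (Diff^{≤i} J|_U)^{∏_{j≠i}(m−j)}` on `U`), `ContactChart.coeffOnH` (`C|_{V(H)}`), `ContactChart.traces E`
  (`(D|_U)|_{V(H)}`, `D ∈ E`), **`ContactChart.residual E := nonmonomialPart C|_{V(H)} (traces E)`** (B1's `N := I·∏_D I(D)^{−a_D}` as the colon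
  `(I : M(I))`), **`ContactChart.value E y := idealOrder (residual E) y`** (`S_H(y) ∈ ℕ∞`).
* §2 **`TameValueIntrinsic φ J m E : Prop`** — THE (G2a) LAW: for any two charts on which `H ∪ E` is snc and any points `y₁ ∈ V(H₁)`, `y₂ ∈ V(H₂)` over the
  same `w ∈ Sing_m(J)`: `S_{H₁}(y₁) = S_{H₂}(y₂)`. STATED ONLY.
* §3 GLUED VALUE of a cover `cov : ContactCover φ J m`: **`ContactCover.value cov E w := ⨅ over charts i and points y ∈ V(H_i) over w of S_{H_i}(y)`**
  (choice-free; `⊤` off the charts); PROVED: `ContactCover.exists_pt_eq` (every `w ∈ Sing_m(J)` lies under some `y ∈ V(H_i)`), `value_le`,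
  **`ContactCover.value_eq`** (under the law: `= S_{H_i}(y)` for ANY chart through `w`), **`ContactCover.le_value_iff`** = (B1)(i) LITERALLY:
  `S₀ ≤ S(w) ↔ S₀ ≤ ord_y N_{H_i}` for any chart `i ∋ w`, and `value_eq_value` (two covers glue to the same `S` on `Sing_m`).

VACUITY SELF-CHECK. `TameValueIntrinsic` has content (two distinct maximal-contact hypersurfaces through a point of `Sing_m` exist as soon as `dim W ≥ 2`; with
the wrong normalisation of `C` it would be FALSE — refuters welcome; it is the (G2a) residue of record, nothing more). §3's theorems are not vacuous: without the
law `value` is only the infimum (`value_le`). The instance of res-L1-type-o1's `RowValueReading` (`sval`) for (51a-F) is `cov.value E ∘ (stage ↪ ambient)`,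
well-defined on `Sing_m` by `value_eq_value`.
-/

noncomputable section

set_option linter.dupNamespace false -- mandated namespace of this single-conjunct summit

open CategoryTheory AlgebraicGeometry TopologicalSpace IsLocalRing
open Literature.AlgebraicGeometry.Resolution

namespace Summit.ResolutionOfSingularities.ResolutionOfSingularities.Theorems.SigmaMaxModificationsCorridor3.Sigma

universe u v

variable {K : Type v} [Field K] {W : Scheme.{u}} {φ : K →+* Γ(W, ⊤)} {J : W.IdealSheafData} {m : ℕ}

/-! ## §1. The residual and its order on one maximal-contact chart -/

namespace ContactChart

/-- The point of `W` under a point `y` of the contact hypersurface `V(H) ⊆ U ⊆ W`. [folklore] -/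
def pt (ch : ContactChart φ J m) (y : ch.H.subscheme) : W :=
  ch.U.ι.base (ch.H.subschemeι.base y)

/-- [OURS · L1 W4.2] **THE `Diff`-COEFFICIENT IDEAL of `(J, m)` on the chart's open `U`**: `Σ_{i<m} (Diff^{≤ i}(J|_U))^{∏_{j≠i}(m−j)}` — the
`Diff^{≤ i}` twin (tree `diffIdealSheaf`) of BGMW's `MarkedIdeal.coeff` (Def. 3.9.2, there with iterated derivations `𝒟ⁱ`), same exponents.
NOT a statement of the manuscript. [cite: BierstoneGrigorievMilmanWlodarczyk2011, Def. 3.9.2] -/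
def coeffIdeal (ch : ContactChart φ J m) : (ch.U : Scheme.{u}).IdealSheafData :=
  ⨆ i : Fin m, diffIdealSheaf (ch.U.ι.appTop.hom.comp φ) i (J.comap ch.U.ι) ^ (∏ j ∈ Finset.univ.erase i, (m - (j : ℕ)))

/-- The coefficient ideal RESTRICTED to the contact hypersurface `V(H)` (BGMW Lemma 3.9.4's `𝒞(𝓘, μ)|_S`). [cite: BierstoneGrigorievMilmanWlodarczyk2011, Lemma 3.9.4] -/
def coeffOnH (ch : ContactChart φ J m) : ch.H.subscheme.IdealSheafData :=
  ch.coeffIdeal.comap ch.H.subschemeι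

/-- The TRACES on `V(H)` of the boundary members: `(D|_U)|_{V(H)}`, `D ∈ E`, in the order of `E`. [folklore] -/
def traces (ch : ContactChart φ J m) (E : List W.IdealSheafData) : List ch.H.subscheme.IdealSheafData :=
  (E.map (·.comap ch.U.ι)).map (·.comap ch.H.subschemeι)

/-- [OURS · L1 W4.2] **THE RESIDUAL `N_H`** of the chart with respect to the boundary `E` (TAME-FORK B1 «`N := I·∏_D I(D)^{−a_D}`, `a_D` = generic order of
`I` along the member `D`»): the nonmonomial part `(C|_{V(H)} : M(C|_{V(H)}))` of the restricted coefficient ideal with respect to the traces (Kollár 3.110,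
tree `nonmonomialPart`). NOT a statement of the manuscript. [cite: Kollar2007, Def.–Lemma 3.110] -/
def residual (ch : ContactChart φ J m) (E : List W.IdealSheafData) : ch.H.subscheme.IdealSheafData :=
  nonmonomialPart ch.coeffOnH (ch.traces E)

/-- [OURS · L1 W4.2] **THE TAME VALUE READ ON THE CHART**: `S_H(y) := ord_y N_H ∈ ℕ∞`. NOT a statement of the manuscript. [folklore] -/
def value (ch : ContactChart φ J m) (E : List W.IdealSheafData) (y : ch.H.subscheme) : ℕ∞ :=
  idealOrder (ch.residual E) y

/-- Unfolding. [folklore] -/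
theorem value_eq (ch : ContactChart φ J m) (E : List W.IdealSheafData) (y : ch.H.subscheme) :
    ch.value E y = idealOrder (ch.residual E) y := rfl

/-- `S_H(y) ≥ S₀` iff `(N_H)_y ⊆ 𝔪_y^{S₀}`. [cite: BierstoneGrigorievMilmanWlodarczyk2011, §3.1 p. 6] -/
theorem le_value_iff (ch : ContactChart φ J m) (E : List W.IdealSheafData) (y : ch.H.subscheme) (S₀ : ℕ) :
    (S₀ : ℕ∞) ≤ ch.value E y ↔ stalkIdeal (ch.residual E) y ≤ (maximalIdeal _) ^ S₀ :=
  le_idealOrder_iff _ _ _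

/-- Every point of `Sing_m(J) ∩ U` lies under a point of `V(H)` (`Sing_m ⊆ V(H)` is the chart's axiom `sing_subset`). [folklore] -/
theorem exists_pt_eq (ch : ContactChart φ J m) {w : W} (hwU : w ∈ ch.U) (hw : (m : ℕ∞) ≤ idealOrder J w) : ∃ y : ch.H.subscheme, ch.pt y = w := by
  have h1 : (⟨w, hwU⟩ : (ch.U : Scheme.{u})) ∈ (ch.H.support : Set (ch.U : Scheme.{u})) := by
    apply ch.sing_subset
    show (m : ℕ∞) ≤ idealOrder (J.comap ch.U.ι) ⟨w, hwU⟩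
    rwa [idealOrder_comap_of_isOpenImmersion]
  rw [← Scheme.IdealSheafData.range_subschemeι] at h1
  obtain ⟨y, hy⟩ := h1
  exact ⟨y, by rw [pt, hy]; rfl⟩

end ContactChart

/-! ## §2. The (G2a) law -/

/-- [OURS · L1 W4.2] **(G2a) «THE TAME VALUE IS INTRINSIC» — STATED, NOT PROVED.** For every two maximal-contact charts of `(J, m)` on which the contact
hypersurface together with the boundary is snc, and every pair of points `y₁ ∈ V(H₁)`, `y₂ ∈ V(H₂)` lying over the SAME point `w ∈ Sing_m(J)`, the residual
orders agree: `S_{H₁}(y₁) = S_{H₂}(y₂)`. Consumers take it as the hypothesis `hG2a` (TAME-FORK B1/B6: «S independent of the choice of H and of the frame,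
at closed AND non-closed points»): `y₁, y₂` range over ALL points of `V(H₁)`, `V(H₂)` — the generic point of a curve inside `Sing_m(J)` is read DIRECTLY
(B1/B2 read `S(η_D)`), not only through `ContactCover.exists_pt_eq`. Keep it VISIBLE as `hG2a` in every consumer signature (res-L1-w42-tri-2 21:16:12Z);
never inline it. NOT a statement of the manuscript; no source asserts it in this form (expected: Cossart–Piltant 2019 Prop. 2.3/2.4-type invariance in
the tame regime `p ∤ m`; in characteristic zero a Kollár-type «tuned ideal» argument). [folklore] -/
def TameValueIntrinsic (φ : K →+* Γ(W, ⊤)) (J : W.IdealSheafData) (m : ℕ) (E : List W.IdealSheafData) : Prop :=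
  ∀ (ch₁ ch₂ : ContactChart φ J m), HasSNC (ch₁.H :: E.map (·.comap ch₁.U.ι)) → HasSNC (ch₂.H :: E.map (·.comap ch₂.U.ι)) →
    ∀ (y₁ : ch₁.H.subscheme) (y₂ : ch₂.H.subscheme), ch₁.pt y₁ = ch₂.pt y₂ → (m : ℕ∞) ≤ idealOrder J (ch₁.pt y₁) →
      ch₁.value E y₁ = ch₂.value E y₂

/-- The law at one chart: two points of `V(H)` over the same `w` read the same value (they are equal — `V(H) → U → W` is injective — so this
holds WITHOUT the law; recorded for the glued value). [folklore] -/
theorem ContactChart.pt_injective (ch : ContactChart φ J m) : Function.Injective ch.pt := fun y₁ y₂ h =>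
  ch.H.subschemeι.isEmbedding.injective (Subtype.ext (by simpa [ContactChart.pt] using h))

/-! ## §3. The glued value of a contact cover; (B1)(i) -/

namespace ContactCover

/-- [OURS · L1 W4.2] **THE GLUED TAME VALUE `S(w)`** of a contact cover: the infimum of the chart readings `S_{H_i}(y)` over all charts `i` and points
`y ∈ V(H_i)` over `w` (CHOICE-FREE; `⊤` when `w` lies under no chart, e.g. off `Sing_m(J)`); under `TameValueIntrinsic` it IS every one of them
(`value_eq`). NOT a statement of the manuscript. [folklore] -/
def value (cov : ContactCover φ J m) (E : List W.IdealSheafData) (w : W) : ℕ∞ :=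
  ⨅ (i : Fin cov.n) (y : (cov.chart i).H.subscheme) (_ : (cov.chart i).pt y = w), (cov.chart i).value E y

/-- The glued value is at most every chart reading over the point. [folklore] -/
theorem value_le (cov : ContactCover φ J m) (E : List W.IdealSheafData) {w : W} (i : Fin cov.n) (y : (cov.chart i).H.subscheme)
    (hy : (cov.chart i).pt y = w) : cov.value E w ≤ (cov.chart i).value E y :=
  (iInf_le _ i).trans ((iInf_le _ y).trans (iInf_le _ hy))

/-- Every point of `Sing_m(J)` lies under a point of some chart's contact hypersurface. [folklore] -/
theorem exists_pt_eq (cov : ContactCover φ J m) {w : W} (hw : (m : ℕ∞) ≤ idealOrder J w) :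
    ∃ (i : Fin cov.n) (y : (cov.chart i).H.subscheme), (cov.chart i).pt y = w := by
  obtain ⟨i, hi⟩ := Set.mem_iUnion.mp (cov.covers hw)
  obtain ⟨y, hy⟩ := (cov.chart i).exists_pt_eq hi hw
  exact ⟨i, y, hy⟩

/-- **Under (G2a) the glued value IS the reading of ANY chart through the point** (charts on which `H ∪ E` is snc). [folklore] -/
theorem value_eq (cov : ContactCover φ J m) (E : List W.IdealSheafData) (hG2a : TameValueIntrinsic φ J m E)
    (hsnc : ∀ i, HasSNC ((cov.chart i).H :: E.map (·.comap (cov.chart i).U.ι))) {w : W} (hw : (m : ℕ∞) ≤ idealOrder J w) (i : Fin cov.n)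
    (y : (cov.chart i).H.subscheme) (hy : (cov.chart i).pt y = w) : cov.value E w = (cov.chart i).value E y := by
  refine le_antisymm (cov.value_le E i y hy) (le_iInf fun j => le_iInf fun y' => le_iInf fun hy' => le_of_eq ?_)
  exact hG2a _ _ (hsnc i) (hsnc j) y y' (hy.trans hy'.symm) (hy ▸ hw)

/-- [OURS · L1 W4.2] **(B1)(i) THROUGH (G2a)**: «`S(w) ≥ S₀`» ⟺ «`ord_y N_{H_i} ≥ S₀`» for ANY chart `i` and point `y ∈ V(H_i)` over `w ∈ Sing_m(J)`.
[folklore] -/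
theorem le_value_iff (cov : ContactCover φ J m) (E : List W.IdealSheafData) (hG2a : TameValueIntrinsic φ J m E)
    (hsnc : ∀ i, HasSNC ((cov.chart i).H :: E.map (·.comap (cov.chart i).U.ι))) {w : W} (hw : (m : ℕ∞) ≤ idealOrder J w) (i : Fin cov.n)
    (y : (cov.chart i).H.subscheme) (hy : (cov.chart i).pt y = w) (S₀ : ℕ) :
    (S₀ : ℕ∞) ≤ cov.value E w ↔ (S₀ : ℕ∞) ≤ idealOrder ((cov.chart i).residual E) y := by
  rw [cov.value_eq E hG2a hsnc hw i y hy, ContactChart.value_eq]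

/-- **Two covers glue to the same value on `Sing_m(J)`** under (G2a). [folklore] -/
theorem value_eq_value (cov cov' : ContactCover φ J m) (E : List W.IdealSheafData) (hG2a : TameValueIntrinsic φ J m E)
    (hsnc : ∀ i, HasSNC ((cov.chart i).H :: E.map (·.comap (cov.chart i).U.ι)))
    (hsnc' : ∀ i, HasSNC ((cov'.chart i).H :: E.map (·.comap (cov'.chart i).U.ι))) {w : W} (hw : (m : ℕ∞) ≤ idealOrder J w) :
    cov.value E w = cov'.value E w := by
  obtain ⟨i, y, hy⟩ := cov.exists_pt_eq hw
  obtain ⟨i', y', hy'⟩ := cov'.exists_pt_eq hw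
  rw [cov.value_eq E hG2a hsnc hw i y hy, cov'.value_eq E hG2a hsnc' hw i' y' hy']
  exact hG2a _ _ (hsnc i) (hsnc' i') y y' (hy.trans hy'.symm) (hy ▸ hw)

end ContactCover

end Summit.ResolutionOfSingularities.ResolutionOfSingularities.Theorems.SigmaMaxModificationsCorridor3.Sigma

end
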